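import Mathlib
import HarnessLib
import Summits.HubbardSuperconductivity.HubbardSuperconductivity.Theorems.KLProgrammeKLRegimeTwoVolumeLipDoubledDefs
import Summits.HubbardSuperconductivity.HubbardSuperconductivity.Theorems.KLProgrammeKLRegimeTwoVolumeDoubledTowerStep
import Summits.HubbardSuperconductivity.HubbardSuperconductivity.Theorems.KLProgrammeKLRegimeTwoVolumeLipBlockIdentity

/-!
# Route `KLProgramme` — crux K3 ENGINE (stmt-HubbardSuperconductivity-20437), stub (e) proof-input «(e)-D-ROWS», keying (A′), REKEY-D file D1:
# THE IDENTITIES OF THE DOUBLED-LABEL TWO-VOLUME LIPSCHITZ TOWER — the spectator step is exact, the doubled transfer re-analyses copy by copy, the one-volume block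
# identity, and the Lipschitz / source split of the doubled born difference (seat hubbard-kl-k3c4-p1 g27; design map HOME/hubbard-kl-k3c4-p1/REKEY-D.md §1 (i)–(iii))

Objects: `…TwoVolumeLipDoubledDefs` (D0).  Generic engine: ✓ `…TwoVolumeDoubledTowerStep` (`effAction_spectatorCov_map_doubleRows_sector`, `doubleBlock_mul_doubleRows`).
Plateau facts of the blocked flow as in the sector-keyed twin ✓ `…TwoVolumeLipBlockIdentity` (`bgmFatMultiplier_mul_bgmMultiplier`,
`sum_klAnisoFamily_eq_one_of_blockSliceCT_ne_zero`, `sum_klAnisoFamily_pred_eq_one_of_klAnisoFamily_ne_zero`) and the semigroup `klTowerIncr_eq_effAction_sub`: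

* §1 `klPlainShift_mul_smul_klPlainAnalysis` — the plain legs are carried identically: `klPlainShift N′ N · (c•klPlainAnalysis N) = c•klPlainAnalysis N′` (the `hB` of the
  doubled-block lemma);
* §2 **`effAction_klLipCovD_klLipInputD`** — `effAction (klLipCov ⊕ 0) (klLipInputD … d k) = map (toLin' (ε•klSrcAnalysisAt … (dk−1))) (effAction Γ_k 𝒱_{dk})` (the spectator step
  of the doubled input IS the doubled analysis of the stepped input); **`klLipTransferD_mul_smul_klSrcAnalysisAt`** — `T⁺_k · (ε•klSrcAnalysisAt (dk−1)) = ε•klSrcAnalysisAt (dk)`;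
  **`klLipBornD_eq_map_step`** — `klLipBornD … d k = map (toLin' T⁺_k) (effAction (klLipCov ⊕ 0) (klLipInputD … d k) − klLipInputD … d k)` (the block identity: the `(f,g)`-reading
  of the deep block-step door with `f = id`, `g = toLin' klLipTransferD`, covariance `klLipCovD`);
* §3 two volumes: `klLipInputD_fine_eq`, **`klLipBornDiffD_eq_lip_add_src`** — `klLipBornDiffD = [map T⁺(born⁺(V + D)) − map T⁺(born⁺ V)] + [map T⁺(born⁺ V) − klGlueD (klLipBornD L)]`,
  `V = klGlueD (klLipInputD L)`, `D = klLipInputDiffD`, `born⁺ Y = effAction klLipCovD Y − Y` — the doubled twin of ✓ `klLipBornDiff_eq_lip_add_src`.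

Identities only (no sizes); nothing asserts the (D) rows, (e), VL, K3 or superconductivity.  References: BGM 2006 §2.7 (2.70)–(2.71), §2.9 (4.3)–(4.6)
[cite: BenfattoGiulianiMastropietro2006]; Salmhofer 1999 App. B.2 (B.23)–(B.25).
-/

noncomputable section

namespace Summit.HubbardSuperconductivity.HubbardSuperconductivity.Theorems.TwoVolumeLip

set_option linter.dupNamespace false -- summit = problem name (single-conjunct summit), D-0017

open Finset Literature.MathematicalPhysics.QuantumLattice GrassmannAlgebra Literature.Probability.LatticeModels
open Literature.MathematicalPhysics.QuantumLattice.FermiRG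
open Summit.HubbardSuperconductivity.HubbardSuperconductivity.Theorems.KLRegimeSplit
open Summit.HubbardSuperconductivity.HubbardSuperconductivity.Theorems.KLProgrammeLegKernels
open Summit.HubbardSuperconductivity.HubbardSuperconductivity.Theorems.EngineV8
open Summit.HubbardSuperconductivity.HubbardSuperconductivity.Theorems.TwoVolumeSource
open Summit.HubbardSuperconductivity.HubbardSuperconductivity.Theorems.TwoVolumeDefect

/-! ## D1 §1 The plain shift reproduces the plain analysis -/

section PlainShift

variable {V M : ℕ} [NeZero V] {N N' : ℕ}

/-- **`klPlainShift N′ N · (c • klPlainAnalysis β N) = c • klPlainAnalysis β N′`** (`N` has the slot `0`): the plain legs are carried identically across re-analyses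
(the hypothesis `hB : J·B = B′` of `TwoVolumeDefect.doubleBlock_mul_doubleRows`). -/
theorem klPlainShift_mul_smul_klPlainAnalysis (hN : 0 < N) (c : ℂ) (β : ℝ) :
    klPlainShift V M N' N * (c • klPlainAnalysis V M β N) = c • klPlainAnalysis V M β N' := by
  ext Y' X
  rw [Matrix.mul_apply, Matrix.smul_apply, smul_eq_mul]
  by_cases h0 : (Y'.2.1.1 : ℕ) = 0
  · -- the unique contributing column label
    set Y₀ : SpaceTimeIdx V M × SectorLeg N := (Y'.1, ((⟨0, hN⟩, Y'.2.1.2), Y'.2.2)) with hY₀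
    rw [Finset.sum_eq_single Y₀]
    · have hshift : klPlainShift V M N' N Y' Y₀ = 1 := by
        rw [klPlainShift_apply, if_pos ⟨rfl, h0, rfl, rfl, rfl⟩]
      have hplain : klPlainAnalysis V M β N Y₀ X = klPlainAnalysis V M β N' Y' X := by
        simp only [klPlainAnalysis, Matrix.of_apply, hY₀, h0, if_true]
      rw [Matrix.smul_apply, smul_eq_mul, hshift, one_mul, hplain]
    · intro Y _ hY
      have hz : klPlainShift V M N' N Y' Y = 0 := by
        rw [klPlainShift_apply, if_neg]
        rintro ⟨h1, -, h3, h4, h5⟩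
        apply hY
        rw [hY₀]
        refine Prod.ext h1.symm (Prod.ext (Prod.ext (Fin.ext h3) h4.symm) h5.symm)
      rw [hz, zero_mul]
    · intro h; exact absurd (Finset.mem_univ _) h
  · have hz : ∀ Y, klPlainShift V M N' N Y' Y = 0 := fun Y => by
      rw [klPlainShift_apply, if_neg]
      rintro ⟨-, h2, -⟩
      exact h0 h2
    simp only [hz, zero_mul, Finset.sum_const_zero]
    simp only [klPlainAnalysis, Matrix.of_apply, h0, if_false, mul_zero]

end PlainShift

/-! ## D1 §2 One volume: the spectator step of the doubled input IS the doubled analysis of the stepped input; the block identity -/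

section OneVolumeId

variable {V M : ℕ} [NeZero V] [NeZero M]

/-- **THE DOUBLED STEP IS EXACT** at block `k` (`β ≠ 0`, `1 ≤ dk`): `effAction (klLipCov ⊕ 0) (klLipInputD … d k) = map (toLin' (ε • klSrcAnalysisAt … (dk−1))) (effAction Γ_k 𝒱_{dk})`,
`Γ_k = C^K_{(Λ_{d(k+1)}, Λ_{dk}]}` — ✓ `TwoVolumeDefect.effAction_spectatorCov_map_doubleRows_sector` at the tower's families (the block covariance lives on the plateau of
`F_{dk−1}`, `F̃_{dk−1}F_{dk−1} = F_{dk−1}`). [cite: BenfattoGiulianiMastropietro2006, §2.9 (4.3)-(4.6)] -/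
theorem effAction_klLipCovD_klLipInputD {β : ℝ} (hβ : β ≠ 0) (U μ : ℝ) (K : TrigPolyC4v) {d k : ℕ} (hdk : 1 ≤ d * k) :
    effAction ℂ (klLipCovD V M β μ K d k) (klLipInputD V M β U μ K d k) =
      ExteriorAlgebra.map (Matrix.toLin' ((((imagTimeWeight β M : ℝ) : ℂ)) • klSrcAnalysisAt V M β μ K (d * k - 1)))
        (effAction ℂ (hubbardCovSliceCT V M β μ 0 K (klScale klE0 (d * (k + 1))) (klScale klE0 (d * k))) (klTowerInput V M β U μ K d k)) := by
  have he : (0 : ℝ) < klE0 := by norm_num [klE0]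
  have hJ : d * k ≤ d * (k + 1) := Nat.mul_le_mul_left d (Nat.le_succ k)
  have hFF : ∀ ω p, bgmFatMultiplier V M klE0 β (nambuXiCT V μ K) (d * k - 1) ω p * klAnisoFamily V M β μ K klE0 (d * k - 1) ω p =
      klAnisoFamily V M β μ K klE0 (d * k - 1) ω p :=
    fun ω p => bgmFatMultiplier_mul_bgmMultiplier he β (nambuXiCT V μ K) (d * k - 1) ω p
  have hCpl : ∀ X Y, hubbardCovSliceCT V M β μ 0 K (klScale klE0 (d * (k + 1))) (klScale klE0 (d * k)) X Y ≠ 0 →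
      ∑ ω, klAnisoFamily V M β μ K klE0 (d * k - 1) ω X.1.1 = 1 ∧ ∑ ω, klAnisoFamily V M β μ K klE0 (d * k - 1) ω Y.1.1 = 1 :=
    fun X Y h => sum_klAnisoFamily_eq_one_of_blockSliceCT_ne_zero β μ K hdk hJ X Y h
  rw [klLipInputD_def]
  exact effAction_spectatorCov_map_doubleRows_sector hβ _ _ hFF _ hCpl (klLipCovD V M β μ K d k)
    (fun p q => by rw [klLipCovD_apply, klLipCov_def])
    ((((imagTimeWeight β M : ℝ) : ℂ)) • klPlainAnalysis V M β (sectorCount (d * k - 1))) _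
    (smul_klSrcAnalysisAt_apply β μ K (d * k - 1)) (klTowerInput V M β U μ K d k)

/-- **The doubled transfer re-analyses copy by copy**: `klLipTransferD … d k · (ε • klSrcAnalysisAt … (dk−1)) = ε • klSrcAnalysisAt … (dk)` (`β ≠ 0`, `1 ≤ dk`: the born family
`F_{dk}` lives on the plateau of `F_{dk−1}`; the plain legs are shifted identically). [cite: BenfattoGiulianiMastropietro2006, §2.7 (2.70)-(2.71)] -/
theorem klLipTransferD_mul_smul_klSrcAnalysisAt {β : ℝ} (hβ : β ≠ 0) (μ : ℝ) (K : TrigPolyC4v) {d k : ℕ} (hdk : 1 ≤ d * k) :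
    klLipTransferD V M β μ K d k * ((((imagTimeWeight β M : ℝ) : ℂ)) • klSrcAnalysisAt V M β μ K (d * k - 1)) =
      (((imagTimeWeight β M : ℝ) : ℂ)) • klSrcAnalysisAt V M β μ K (d * k) := by
  have he : (0 : ℝ) < klE0 := by norm_num [klE0]
  have hFF : ∀ ω p, bgmFatMultiplier V M klE0 β (nambuXiCT V μ K) (d * k - 1) ω p * klAnisoFamily V M β μ K klE0 (d * k - 1) ω p =
      klAnisoFamily V M β μ K klE0 (d * k - 1) ω p :=
    fun ω p => bgmFatMultiplier_mul_bgmMultiplier he β (nambuXiCT V μ K) (d * k - 1) ω p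
  have hF'pl : ∀ (ω' : Fin (sectorCount (d * k))) (p : FreqMomentum V M), klAnisoFamily V M β μ K klE0 (d * k) ω' p ≠ 0 →
      ∑ ω, klAnisoFamily V M β μ K klE0 (d * k - 1) ω p = 1 :=
    fun ω' p h => sum_klAnisoFamily_pred_eq_one_of_klAnisoFamily_ne_zero β μ K hdk le_rfl ω' p h
  have hA : klLipTransfer V M β μ K d k * ((((imagTimeWeight β M : ℝ) : ℂ)) • sectorAnalysisMatrix V M β (klAnisoFamily V M β μ K klE0 (d * k - 1))) =
      (((imagTimeWeight β M : ℝ) : ℂ)) • sectorAnalysisMatrix V M β (klAnisoFamily V M β μ K klE0 (d * k)) := by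
    rw [klLipTransfer_def]
    exact smul_sectorAnalysis_mul_sectorSub_mul_smul_sectorAnalysis hβ _ _ hFF _ hF'pl
  have hB := klPlainShift_mul_smul_klPlainAnalysis (V := V) (M := M) (N' := sectorCount (d * k)) (sectorCount_pos (d * k - 1))
    (((imagTimeWeight β M : ℝ) : ℂ)) β
  exact doubleBlock_mul_doubleRows (klLipTransfer V M β μ K d k) (klPlainShift V M (sectorCount (d * k)) (sectorCount (d * k - 1)))
    (klLipTransferD V M β μ K d k) (klLipTransferD_apply β μ K d k) _ _ _ _ hA hB _ (smul_klSrcAnalysisAt_apply β μ K (d * k - 1)) _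
    (smul_klSrcAnalysisAt_apply β μ K (d * k))

/-- **THE ONE-VOLUME BLOCK IDENTITY OF THE DOUBLED TOWER**: for `β ≠ 0`, `1 ≤ dk`, `Z^K_{Λ_{dk}} ≠ 0`,
`klLipBornD … d k = map (toLin' klLipTransferD) (effAction klLipCovD (klLipInputD … d k) − klLipInputD … d k)` — the born increment of block `k` on the doubled labels is ONE
substitution of the spectator-step born term of the doubled input (the `(f, g)`-reading of the deep block-step door with `f = id`, `g = toLin' klLipTransferD`,
covariance `klLipCovD`). [cite: BenfattoGiulianiMastropietro2006, §2.7 (2.70)-(2.71)] -/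
theorem klLipBornD_eq_map_step {β : ℝ} (hβ : β ≠ 0) (U μ : ℝ) (K : TrigPolyC4v) {d k : ℕ} (hdk : 1 ≤ d * k)
    (hZ : hubbardEffPartitionFnCT V M β U μ 0 K (klScale klE0 (d * k)) ≠ 0) :
    klLipBornD V M β U μ K d k =
      ExteriorAlgebra.map (Matrix.toLin' (klLipTransferD V M β μ K d k))
        (effAction ℂ (klLipCovD V M β μ K d k) (klLipInputD V M β U μ K d k) - klLipInputD V M β U μ K d k) := by
  rw [effAction_klLipCovD_klLipInputD hβ U μ K hdk, klLipInputD_def, ← map_sub, ← klTowerIncr_eq_effAction_sub β U μ K d k hZ, klLipBornD_def,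
    map_map_eq_map_comp, ← Matrix.toLin'_mul, klLipTransferD_mul_smul_klSrcAnalysisAt hβ μ K hdk]

end OneVolumeId

/-! ## D1 §3 Two volumes at the common frame: the doubled born difference = Lipschitz part + source part -/

section TwoVolumesId

variable {L b M : ℕ} [NeZero L] [NeZero (b * L)] [NeZero M]

omit [NeZero M] in
/-- `klLipInputD (bL) = klGlueD (klLipInputD L) + klLipInputDiffD` (definition of the difference). -/
theorem klLipInputD_fine_eq (β U μ : ℝ) (K : TrigPolyC4v) (d k : ℕ) :
    klLipInputD (b * L) M β U μ K d k = klGlueD L b M (d * k - 1) (klLipInputD L M β U μ K d k) + klLipInputDiffD L b M β U μ K d k := by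
  rw [klLipInputDiffD_def, add_sub_cancel]

/-- **THE DOUBLED BORN DIFFERENCE SPLITS INTO THE LIPSCHITZ PART AND THE SOURCE PART** (common frame `K`, block `k`, `1 ≤ dk`, fine partition function `≠ 0`;
`born⁺ Y := effAction klLipCovD^{bL} Y − Y`, `V := klGlueD (klLipInputD L … d k)`, `V + klLipInputDiffD = klLipInputD (bL)`):
`klLipBornDiffD = [map T⁺(born⁺(V + D)) − map T⁺(born⁺ V)] + [map T⁺(born⁺ V) − klGlueD (klLipBornD L … d k)]`. [cite: BenfattoGiulianiMastropietro2006, §2.7 (2.70)-(2.71)] -/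
theorem klLipBornDiffD_eq_lip_add_src {β : ℝ} (hβ : β ≠ 0) (U μ : ℝ) (K : TrigPolyC4v) {d k : ℕ} (hdk : 1 ≤ d * k)
    (hZ : hubbardEffPartitionFnCT (b * L) M β U μ 0 K (klScale klE0 (d * k)) ≠ 0) :
    klLipBornDiffD L b M β U μ K d k =
      (ExteriorAlgebra.map (Matrix.toLin' (klLipTransferD (b * L) M β μ K d k))
          (effAction ℂ (klLipCovD (b * L) M β μ K d k)
              (klGlueD L b M (d * k - 1) (klLipInputD L M β U μ K d k) + klLipInputDiffD L b M β U μ K d k) -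
            (klGlueD L b M (d * k - 1) (klLipInputD L M β U μ K d k) + klLipInputDiffD L b M β U μ K d k)) -
        ExteriorAlgebra.map (Matrix.toLin' (klLipTransferD (b * L) M β μ K d k))
          (effAction ℂ (klLipCovD (b * L) M β μ K d k) (klGlueD L b M (d * k - 1) (klLipInputD L M β U μ K d k)) -
            klGlueD L b M (d * k - 1) (klLipInputD L M β U μ K d k))) +
      (ExteriorAlgebra.map (Matrix.toLin' (klLipTransferD (b * L) M β μ K d k))
          (effAction ℂ (klLipCovD (b * L) M β μ K d k) (klGlueD L b M (d * k - 1) (klLipInputD L M β U μ K d k)) -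
            klGlueD L b M (d * k - 1) (klLipInputD L M β U μ K d k)) -
        klGlueD L b M (d * k) (klLipBornD L M β U μ K d k)) := by
  rw [klLipBornDiffD_def, klLipBornD_eq_map_step (V := b * L) hβ U μ K hdk hZ, klLipInputD_fine_eq (L := L) (b := b) β U μ K d k]
  abel

end TwoVolumesId

end Summit.HubbardSuperconductivity.HubbardSuperconductivity.Theorems.TwoVolumeLip

end
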